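import Summits.ResolutionOfSingularities.ResolutionOfSingularities.Theorems.EquisingularLiftEquisingularLiftNatTowerRoundBDoublePrimeDefs
import Summits.ResolutionOfSingularities.ResolutionOfSingularities.Theorems.EquisingularLiftEquisingularLiftNatTowerBRoundOfFact
import HarnessLib

/-!
# [OURS · L1 W4.5(b) · EL♮(3) · T23-A″] The PAIR-ROUND ARM of the engine V10″ — menu dispatch over an abstract pair-round supplier

res-L1-w45b-stub-2 g12, desk R20 (ii) («stub-2 … then V10″ = …NatTowerBPrimeAssembly + the pair `rcases` arm, §4») and res-L1-w45b-stub-4's ENGINE WORD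
`T23Adprime-ENGINE-WORD.md` 16d03a46d50c8ccd §2 CALLING CONVENTION / §4. The third disjunct of res-L1-w45b-lead-2's `TowerRoundBDoublePrime`
(…NatTowerRoundBDoublePrimeDefs p616048) hands the assembly a host `Hst ∈ E :: Es`, a witness `W ∈ E :: Es`, `Hst ≠ W`, `ConeWitness G Hst hH W Z hZ`, `Z̃` regular,
`E' = υ₂⁻¹Z` and the shadow menu `K' = ∅ ∨ ((((Hst = E ∨ W = E) ∧ closure (Z ∖ closure K) = Z) ∨ Disjoint Z (closure K)) ∧ K' = closure υ₂⁻¹(K ∖ Z))`;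
the upstairs round-of-fact″ (stub-4, over `Tower.invB_pairRoundCore` p615801) is called with host datum `(H, KH) ∈ {(E, K), (member, ∅)}`, a witness, and the
HOST-form menu `K'' = ∅ ∨ (closure (Z ∖ closure KH) = Z ∧ K'' = closure υ₂⁻¹(KH ∖ Z))`. THIS FILE is the pure-logic DISPATCH between the two (five calls:
no shadow ×2 hosts, cone shadow through `Hst = E`, cone shadow through `W = E` with the witness hosting — `ConeWitness` and the B″ transports are symmetric —,
«Disjoint» shadow = a shadow-free round then the TRIVIAL cone `Tower.invB_shadow_of_disjoint`), over an ABSTRACT supplier `hS` (instantiated in V10″ by the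
round-of-fact″) and an abstract exceptional-surface datum `Ruled`; plus the K′ side facts of the B-tower invariant. OURS; pure logic + point-set topology;
NOT a statement of any manuscript; AI-written, weaker than expert review. No `sorry`; standard axioms; DEF-FREE. `--supports stmt-ResolutionOfSingularities-20148 --as helper`.
-/

set_option linter.dupNamespace false -- mandated namespace `Summit.<Summit>.<Problem>` of this single-conjunct summit

noncomputable section

open CategoryTheory CategoryTheory.Limits AlgebraicGeometry TopologicalSpace Topology
open Literature.AlgebraicGeometry.Resolution
open AlgebraicGeometry.Scheme.IdealSheafData

namespace Summit.ResolutionOfSingularities.ResolutionOfSingularities.Cruxes.EquisingularLiftNat.Sections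

/-! ## Pure-logic helpers for the witness binder `W` -/

/-- At a round whose witness is its host, a B″ transport is a B′ transport. [OURS · pure logic] -/
theorem roundTransportOKPrime_of_roundTransportOKDoublePrime_self {G G' : Scheme.{0}} {υ₂ : G' ⟶ G} {Z : Set G} {hZ : IsClosed Z}
    {Hst F : Set G} {F' : Set G'} (h : RoundTransportOKDoublePrime υ₂ Z hZ Hst Hst F F') : RoundTransportOKPrime υ₂ Z hZ Hst F F' :=
  ⟨h.1.elim Or.inl fun h' => h'.elim Or.inl Or.inr, h.2⟩

/-- B″ transports are symmetric in host and witness. [OURS · pure logic] -/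
theorem roundTransportOKDoublePrime_swap {G G' : Scheme.{0}} {υ₂ : G' ⟶ G} {Z : Set G} {hZ : IsClosed Z} {Hst W F : Set G} {F' : Set G'}
    (h : RoundTransportOKDoublePrime υ₂ Z hZ Hst W F F') : RoundTransportOKDoublePrime υ₂ Z hZ W Hst F F' :=
  ⟨h.1.elim (fun h' => Or.inr (Or.inl h')) fun h' => h'.elim Or.inl fun h'' => Or.inr (Or.inr h''), h.2⟩

/-- `ConeWitness` is symmetric for two CLOSED members (`Z = H ∩ W`, `𝓘⟨H⟩ ⊔ 𝓘⟨W⟩ = 𝓘⟨Z⟩`). [OURS · pure logic] -/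
theorem coneWitness_symm {G : Scheme.{0}} {H W Z : Set G} (hH : IsClosed H) (hW : IsClosed W) {hZ : IsClosed Z}
    (h : ConeWitness G H hH W Z hZ) : ConeWitness G W hW H Z hZ := by
  obtain ⟨h1, h2⟩ := h
  have eW : (⟨closure W, isClosed_closure⟩ : Closeds G) = ⟨W, hW⟩ := Closeds.ext hW.closure_eq
  have eH : (⟨closure H, isClosed_closure⟩ : Closeds G) = ⟨H, hH⟩ := Closeds.ext hH.closure_eq
  refine ⟨?_, ?_⟩
  · rw [hH.closure_eq, Set.inter_comm, ← hW.closure_eq]; exact h1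
  · rw [eH, sup_comm, ← eW]; exact h2

/-! ## The K′ side facts of the B-tower invariant after a round with `E' = υ₂⁻¹Z` -/

/-- After a round with new running surface `υ₂⁻¹Z` and transported shadow `K' = closure υ₂⁻¹(KH ∖ Z)` (`KH` closed, `≠ univ`; `¬ T ⊆ Z`), the shadow is
closed, dense off the running surface and not everything. [OURS · point-set topology] -/
theorem shadow_sideFacts_preimage {G G' : Scheme.{0}} [IsIntegral G] (υ₂ : G' ⟶ G) {Z : Set G} (hZ : IsClosed Z)
    (hυ₂ : IsBlowup υ₂ (vanishingIdeal (⟨Z, hZ⟩ : Closeds G))) {T KH : Set G} (hKHcl : IsClosed KH) (hKHne : KH ≠ Set.univ) (hTZ : ¬ T ⊆ Z) :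
    IsClosed (closure (υ₂ ⁻¹' (KH \ Z))) ∧
      closure (υ₂ ⁻¹' (KH \ Z)) ⊆ closure (closure (υ₂ ⁻¹' (KH \ Z)) \ υ₂ ⁻¹' Z) ∧ closure (υ₂ ⁻¹' (KH \ Z)) ≠ Set.univ := by
  have hZsupp : ((vanishingIdeal (⟨Z, hZ⟩ : Closeds G) : G.IdealSheafData).support : Set G) = Z :=
    Scheme.IdealSheafData.coe_support_vanishingIdeal _
  exact ⟨isClosed_closure, closure_preimage_diff_subset_closure_diff_preimage υ₂ KH Z,
    closure_preimage_ne_univ υ₂ _ hυ₂ KH Z hKHcl hKHne hZ (fun h => hTZ (h ▸ Set.subset_univ _)) hZsupp.le _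
      (Set.preimage_mono fun z hz => hz.1)⟩

/-! ## The pair-round arm -/

section PairArm

variable (O : Type) [CommRing O] (k : Type) [Field k] (θ : O →+* k) (P : Scheme.{0}) (q : P ⟶ Spec (.of O)) (Y : Set P)
  (Ch : ∀ X' : Scheme.{0}, (X' ⟶ P) → Set X' → Prop) (Ruled : Tower.RuledDatum P)

/-- **The PAIR-ROUND ARM of V10″ (menu dispatch).** Given the data of the third disjunct of `TowerRoundBDoublePrime` at a stage carrying the B-tower invariant
(`Tower.InvB` with its shadow side facts) and an abstract PAIR-ROUND SUPPLIER `hS` — «for any host datum `(H, KH) ∈ {(E, K), (member, ∅)}`, witness `W' ∈ E :: Es`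
with `H ≠ W'`, `ConeWitness G H hH W' Z hZ`, HOST-form shadow menu and B″ transports with host `H` / witness `W'`, the invariant holds on `G'` with running surface
`υ₂⁻¹Z`» (in V10″: res-L1-w45b-stub-4's round-of-fact″ over `Tower.invB_pairRoundCore`) — the invariant and its side facts hold on `G'` for the DOWNSTAIRS
menu `K'`. Calling convention of the engine word §2: `E ∈ {Hst, W}` ⇒ host `E` with shadow `K` (witness the other member; `ConeWitness`/transports swapped by
`coneWitness_symm` / `roundTransportOKDoublePrime_swap`); else host `Hst` with shadow `∅`; a «Disjoint» shadow is re-attached by `Tower.invB_shadow_of_disjoint`.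
[folklore; pure logic] [OURS · L1 W4.5b · T23-A″ V10″] toward the rung″ `stub_elnat_defTowerBDoublePrimePointResolutionThree`; NOT a statement of the manuscript. -/
theorem Tower.invB_pairDisjunct_of_supplier {F₉ : Scheme.{0}} (Z₉ : Set F₉) (hZ₉ : IsClosed Z₉) {F₁₀ : Scheme.{0}} (υ' : F₁₀ ⟶ F₉)
    (G G' : Scheme.{0}) (γ : G ⟶ F₁₀) (T E : Set G) (Es : List (Set G)) (K : Set G) (Z : Set G) (hZ : IsClosed Z) (Hst W : Set G)
    (υ₂ : G' ⟶ G) (K' : Set G') (Es' : List (Set G'))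
    (hI : Tower.InvB O k θ P q Y Ch Ruled F₉ Z₉ hZ₉ F₁₀ υ' G γ T E Es K ∧ IsClosed K ∧ K ⊆ closure (K \ E) ∧ K ≠ Set.univ)
    (hHmem : Hst ∈ E :: Es) (hWmem : W ∈ E :: Es) (hHW : Hst ≠ W) (hH : IsClosed Hst) (hW : IsClosed W) (hpair : ConeWitness G Hst hH W Z hZ)
    (hυ₂ : IsBlowup υ₂ (vanishingIdeal (⟨Z, hZ⟩ : Closeds G)))
    (hK' : K' = ∅ ∨ ((((Hst = E ∨ W = E) ∧ closure (Z \ closure K) = Z) ∨ Disjoint Z (closure K)) ∧ K' = closure (υ₂ ⁻¹' (K \ Z))))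
    (hEs' : ∀ F' ∈ Es', ∃ F ∈ E :: Es, RoundTransportOKDoublePrime υ₂ Z hZ Hst W F F')
    (hS : ∀ (H KH : Set G) (hH' : IsClosed H) (W' : Set G) (_hW' : IsClosed W') (K'' : Set G'),
      ((H = E ∧ KH = K) ∨ (H ∈ Es ∧ KH = ∅)) → W' ∈ E :: Es → H ≠ W' → ConeWitness G H hH' W' Z hZ →
      (K'' = ∅ ∨ (closure (Z \ closure KH) = Z ∧ K'' = closure (υ₂ ⁻¹' (KH \ Z)))) →
      (∀ F' ∈ Es', ∃ F ∈ E :: Es, RoundTransportOKDoublePrime υ₂ Z hZ H W' F F') →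
      Tower.InvB O k θ P q Y Ch Ruled F₉ Z₉ hZ₉ F₁₀ υ' G' (υ₂ ≫ γ) (closure (υ₂ ⁻¹' (T \ Z))) (υ₂ ⁻¹' Z) Es' K'') :
    Tower.InvB O k θ P q Y Ch Ruled F₉ Z₉ hZ₉ F₁₀ υ' G' (υ₂ ≫ γ) (closure (υ₂ ⁻¹' (T \ Z))) (υ₂ ⁻¹' Z) Es' K' ∧
      IsClosed K' ∧ K' ⊆ closure (K' \ υ₂ ⁻¹' Z) ∧ K' ≠ Set.univ := by
  obtain ⟨hinv, hKcl, hKE, hKne⟩ := id hI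
  have hGint : IsIntegral G := hinv.2.2.1
  haveI := hGint
  have hTE : ¬ T ⊆ E := hinv.2.2.2.2.2.2.1
  have hEsB := hinv.2.2.2.2.2.2.2.1
  have hZH : Z ⊆ Hst := fun z hz => (hpair.1.le hz).1
  have hTHst : ¬ T ⊆ Hst := by
    rcases List.mem_cons.mp hHmem with rfl | h
    · exact hTE
    · exact (hEsB Hst h).2
  have hTZ : ¬ T ⊆ Z := fun h => hTHst (h.trans hZH)
  -- the symmetric data (witness as host)
  have hpair' : ConeWitness G W hW Hst Z hZ := coneWitness_symm hH hW hpair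
  have hEs'sw : ∀ F' ∈ Es', ∃ F ∈ E :: Es, RoundTransportOKDoublePrime υ₂ Z hZ W Hst F F' := fun F' hF' =>
    let ⟨F, hF, h⟩ := hEs' F' hF'; ⟨F, hF, roundTransportOKDoublePrime_swap h⟩
  -- side facts of the empty shadow
  have hempty : ∀ {Es₀ : List (Set G')},
      Tower.InvB O k θ P q Y Ch Ruled F₉ Z₉ hZ₉ F₁₀ υ' G' (υ₂ ≫ γ) (closure (υ₂ ⁻¹' (T \ Z))) (υ₂ ⁻¹' Z) Es₀ ∅ →
      Tower.InvB O k θ P q Y Ch Ruled F₉ Z₉ hZ₉ F₁₀ υ' G' (υ₂ ≫ γ) (closure (υ₂ ⁻¹' (T \ Z))) (υ₂ ⁻¹' Z) Es₀ ∅ ∧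
        IsClosed (∅ : Set G') ∧ (∅ : Set G') ⊆ closure (∅ \ υ₂ ⁻¹' Z) ∧ (∅ : Set G') ≠ Set.univ := by
    intro Es₀ hB
    have hG'int : IsIntegral G' := hB.2.2.1
    haveI := hG'int
    exact ⟨hB, isClosed_empty, Set.empty_subset _, Set.empty_ne_univ⟩
  rcases hK' with rfl | ⟨⟨hHE | hWE, hcl⟩ | hZK, rfl⟩
  · -- no shadow: host `Hst` (as `E` with `K`, or as a member with `∅`), witness `W`
    rcases List.mem_cons.mp hHmem with rfl | hHEs
    · exact hempty (hS Hst K hH W hW ∅ (Or.inl ⟨rfl, rfl⟩) hWmem hHW hpair (Or.inl rfl) hEs')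
    · exact hempty (hS Hst ∅ hH W hW ∅ (Or.inr ⟨hHEs, rfl⟩) hWmem hHW hpair (Or.inl rfl) hEs')
  · -- cone shadow through the host `Hst = E`
    subst hHE
    exact ⟨hS Hst K hH W hW _ (Or.inl ⟨rfl, rfl⟩) hWmem hHW hpair (Or.inr ⟨hcl, rfl⟩) hEs', shadow_sideFacts_preimage υ₂ hZ hυ₂ hKcl hKne hTZ⟩
  · -- cone shadow through the witness `W = E`: the witness hosts, `Hst` witnesses
    subst hWE
    exact ⟨hS W K hW Hst hH _ (Or.inl ⟨rfl, rfl⟩) hHmem (Ne.symm hHW) hpair' (Or.inr ⟨hcl, rfl⟩) hEs'sw,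
      shadow_sideFacts_preimage υ₂ hZ hυ₂ hKcl hKne hTZ⟩
  · -- «Disjoint» shadow: a shadow-free pair round, then the trivial cone
    have hsub : closure (υ₂ ⁻¹' (K \ Z)) ⊆ υ₂ ⁻¹' closure K :=
      closure_minimal (fun z hz => subset_closure hz.1) (isClosed_closure.preimage υ₂.continuous)
    have hEK : Disjoint (υ₂ ⁻¹' Z) (closure (closure (υ₂ ⁻¹' (K \ Z)))) := by
      rw [closure_closure]
      refine Set.disjoint_left.mpr fun z hzZ hzK => ?_
      exact (Set.disjoint_left.mp hZK) hzZ (hsub hzK)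
    have hB₀ : Tower.InvB O k θ P q Y Ch Ruled F₉ Z₉ hZ₉ F₁₀ υ' G' (υ₂ ≫ γ) (closure (υ₂ ⁻¹' (T \ Z))) (υ₂ ⁻¹' Z) Es' ∅ := by
      rcases List.mem_cons.mp hHmem with rfl | hHEs
      · exact hS Hst K hH W hW ∅ (Or.inl ⟨rfl, rfl⟩) hWmem hHW hpair (Or.inl rfl) hEs'
      · exact hS Hst ∅ hH W hW ∅ (Or.inr ⟨hHEs, rfl⟩) hWmem hHW hpair (Or.inl rfl) hEs'
    exact ⟨Tower.invB_shadow_of_disjoint O k θ P q Y Ch Ruled F₉ Z₉ hZ₉ F₁₀ υ' G' (υ₂ ≫ γ) _ _ Es' _ hB₀ hEK,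
      shadow_sideFacts_preimage υ₂ hZ hυ₂ hKcl hKne hTZ⟩

end PairArm

end Summit.ResolutionOfSingularities.ResolutionOfSingularities.Cruxes.EquisingularLiftNat.Sections

end
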